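import Mathlib.Algebra.Order.Chebyshev
import Mathlib.Data.Real.Basic
import Mathlib.Data.Fin.VecNotation
import Mathlib.Tactic

/-!
# `CoherentDephasing` / line `Sketch`, strict absorption: the `N`-uniform size of `G₃ = L³ p₀` (scalar part)

Companion (support file 1/2) of stub `sa_generatorCube` (sub-goal K4a' of the lead's `N`-uniform
strict-absorption skeleton) of crux `stmt-AtomisticToContinuum-11810` (`PhononMeanFreePath.CoherentDephasing`).
The third generator power `G₃ = L G₂` at the kicked site of the pinned anharmonic chain is an explicit polynomial
of degree `5` in the five local variables `q₀, q₁, q₂, p₀, p₁` (computed in `…GeneratorCube`); here we prove the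
purely real-variable inequality `|G₃| ≤ C (1 + q₀⁶ + p₀⁶ + q₁⁶ + p₁⁶ + q₂⁶)` with `C = C(ω₂, lam, β, γ)`
(`genCube_polyBound`), which is what makes the local bound of the stub uniform in the chain length: with
`K = 1 + |q₀| + |q₁| + |q₂| + |p₀| + |p₁|`, interval arithmetic along the expression tree (every variable
replaced by `K`, constants padded by powers of `K`) gives `|G₃| ≤ C K⁵`, and
`K⁵ ≤ K⁶ ≤ 6⁵ (1 + q₀⁶ + q₁⁶ + q₂⁶ + p₀⁶ + p₁⁶)` (power mean, `pow_sum_le_card_mul_sum_pow`). All [folklore].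
-/

noncomputable section

namespace Summit.AtomisticToContinuum.FouriersLaw.Theorems.CoherentDephasing.StrictAbsorption

/-! ### The scalar polynomial bound -/

/-- The local size parameter `K = 1 + |q₀| + |q₁| + |q₂| + |p₀| + |p₁|`: it dominates `1`, the five variables and
the two stretches, and `K⁶ ≤ 6⁵ (1 + q₀⁶ + q₁⁶ + q₂⁶ + p₀⁶ + p₁⁶)` (power mean). [folklore] -/
theorem genCube_normK (q₀ q₁ q₂ p₀ p₁ : ℝ) :
    ∃ K : ℝ, 1 ≤ K ∧ |q₀| ≤ K ∧ |q₁| ≤ K ∧ |q₂| ≤ K ∧ |p₀| ≤ K ∧ |p₁| ≤ K ∧ |q₁ - q₀| ≤ K ∧ |q₂ - q₁| ≤ K ∧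
      K ^ 6 ≤ 7776 * (1 + (q₀ ^ 6 + p₀ ^ 6) + (q₁ ^ 6 + p₁ ^ 6) + q₂ ^ 6) := by
  have h0 := abs_nonneg q₀
  have h1 := abs_nonneg q₁
  have h2 := abs_nonneg q₂
  have h3 := abs_nonneg p₀
  have h4 := abs_nonneg p₁
  refine ⟨1 + |q₀| + |q₁| + |q₂| + |p₀| + |p₁|, by linarith, by linarith, by linarith, by linarith, by linarith,
    by linarith, (abs_sub _ _).trans (by linarith), (abs_sub _ _).trans (by linarith), ?_⟩
  have hf : ∀ i ∈ (Finset.univ : Finset (Fin 6)), 0 ≤ ![(1 : ℝ), |q₀|, |q₁|, |q₂|, |p₀|, |p₁|] i := by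
    intro i _
    fin_cases i <;> simp
  have h := pow_sum_le_card_mul_sum_pow hf 5
  have hs : ∑ i, ![(1 : ℝ), |q₀|, |q₁|, |q₂|, |p₀|, |p₁|] i = 1 + |q₀| + |q₁| + |q₂| + |p₀| + |p₁| := by
    simp [Fin.sum_univ_succ]
    ring
  have h6 : ∀ a : ℝ, |a| ^ 6 = a ^ 6 := fun a => Even.pow_abs (by decide) a
  have hs6 : ∑ i, ![(1 : ℝ), |q₀|, |q₁|, |q₂|, |p₀|, |p₁|] i ^ (5 + 1) =
      1 + (q₀ ^ 6 + p₀ ^ 6) + (q₁ ^ 6 + p₁ ^ 6) + q₂ ^ 6 := by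
    simp [Fin.sum_univ_succ, h6]
    ring
  rw [hs, hs6, Finset.card_univ, Fintype.card_fin] at h
  norm_num at h
  exact h

/-- **The `N`-uniform polynomial bound.** The explicit degree-`5` polynomial `G₃(q₀, q₁, q₂, p₀, p₁)` satisfies
`|G₃| ≤ C (1 + q₀⁶ + p₀⁶ + q₁⁶ + p₁⁶ + q₂⁶)` with `C = C(ω₂, lam, β, γ)` independent of the chain length: with
`K` as in `genCube_normK`, interval arithmetic along the expression tree (every variable replaced by `K`, every
constant padded by a power of `K`) gives `|G₃| ≤ C K⁵ ≤ C K⁶`. [folklore] -/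
theorem genCube_polyBound :
    ∀ {ω₂ lam β γ : ℝ}, 0 ≤ ω₂ → 0 ≤ lam → 0 ≤ β → 0 ≤ γ → ∃ C : ℝ, 0 ≤ C ∧ ∀ q₀ q₁ q₂ p₀ p₁ : ℝ,
      |(p₀ * (-(p₀ * (6 * lam * q₀ - 6 * β * (q₁ - q₀))) - p₁ * (6 * β * (q₁ - q₀)) +
              γ * (ω₂ + 3 * lam * q₀ ^ 2 + 1 + 3 * β * (q₁ - q₀) ^ 2)) +
            p₁ * (-(p₀ * (6 * β * (q₁ - q₀))) + p₁ * (6 * β * (q₁ - q₀)) - γ * (1 + 3 * β * (q₁ - q₀) ^ 2)) -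
            (ω₂ * q₀ + lam * q₀ ^ 3 - ((q₁ - q₀) + β * (q₁ - q₀) ^ 3)) *
              (-(ω₂ + 3 * lam * q₀ ^ 2 + 1 + 3 * β * (q₁ - q₀) ^ 2) + γ ^ 2) -
            (ω₂ * q₁ + lam * q₁ ^ 3 - (((q₂ - q₁) + β * (q₂ - q₁) ^ 3) - ((q₁ - q₀) + β * (q₁ - q₀) ^ 3))) *
              (1 + 3 * β * (q₁ - q₀) ^ 2) -
            γ * (p₀ * (-(ω₂ + 3 * lam * q₀ ^ 2 + 1 + 3 * β * (q₁ - q₀) ^ 2) + γ ^ 2)))| ≤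
        C * (1 + (q₀ ^ 6 + p₀ ^ 6) + (q₁ ^ 6 + p₁ ^ 6) + q₂ ^ 6) := by
  intro ω₂ lam β γ hω hl hβ hγ
  obtain ⟨C, hC⟩ : ∃ C : ℝ, C =
      6 * lam + 12 * β + γ * (ω₂ + 3 * lam + 1 + 3 * β) + (12 * β + γ * (1 + 3 * β)) +
      (ω₂ + lam + 1 + β) * (ω₂ + 3 * lam + 1 + 3 * β + γ ^ 2) + (ω₂ + lam + 2 + 2 * β) * (1 + 3 * β) +
      γ * (ω₂ + 3 * lam + 1 + 3 * β + γ ^ 2) := ⟨_, rfl⟩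
  have hC0 : 0 ≤ C := by rw [hC]; positivity
  refine ⟨7776 * C, by positivity, fun q₀ q₁ q₂ p₀ p₁ => ?_⟩
  obtain ⟨K, hK1, hq0, hq1, hq2, hp0, hp1, hr, hs, hK6⟩ := genCube_normK q₀ q₁ q₂ p₀ p₁
  -- interval-arithmetic combinators
  have icst : ∀ {c : ℝ}, 0 ≤ c → |c| ≤ c := fun hc => (abs_of_nonneg hc).le
  have ineg : ∀ {x a : ℝ}, |x| ≤ a → |-x| ≤ a := fun hx => by rwa [abs_neg]
  have iadd : ∀ {x y a b : ℝ}, |x| ≤ a → |y| ≤ b → |x + y| ≤ a + b :=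
    fun hx hy => (abs_add_le _ _).trans (add_le_add hx hy)
  have isub : ∀ {x y a b : ℝ}, |x| ≤ a → |y| ≤ b → |x - y| ≤ a + b :=
    fun hx hy => (abs_sub _ _).trans (add_le_add hx hy)
  have imul : ∀ {x y a b : ℝ}, |x| ≤ a → |y| ≤ b → |x * y| ≤ a * b :=
    fun hx hy => by rw [abs_mul]; exact mul_le_mul hx hy (abs_nonneg _) ((abs_nonneg _).trans hx)
  have ipow : ∀ {x a : ℝ}, |x| ≤ a → ∀ n : ℕ, |x ^ n| ≤ a ^ n :=
    fun hx n => by rw [abs_pow]; exact pow_le_pow_left₀ (abs_nonneg _) hx n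
  have ilift : ∀ {x a : ℝ}, |x| ≤ a → ∀ s : ℕ, |x| ≤ a * K ^ s :=
    fun hx s => hx.trans (le_mul_of_one_le_right ((abs_nonneg _).trans hx) (one_le_pow₀ hK1))
  have c1 : |(1 : ℝ)| ≤ 1 := icst zero_le_one
  have c3 : |(3 : ℝ)| ≤ 3 := icst (by norm_num)
  have c6 : |(6 : ℝ)| ≤ 6 := icst (by norm_num)
  have cω := icst hω
  have cl := icst hl
  have cβ := icst hβ
  have cγ := icst hγ
  -- `|Φ| ≤ (ω₂ + 3 lam + 1 + 3β) K²` for `Φ = ω₂ + 3 lam q₀² + 1 + 3β (q₁ - q₀)²`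
  have hΦ := iadd (iadd (iadd (ilift cω 2) (imul (imul c3 cl) (ipow hq0 2))) (ilift c1 2))
    (imul (imul c3 cβ) (ipow hr 2))
  -- `|∂_{q₀}G₂| ≤ (6 lam + 12β + γ (ω₂ + 3 lam + 1 + 3β)) K²`, `|∂_{q₁}G₂| ≤ (12β + γ (1 + 3β)) K²`
  have hA₀ := iadd (isub (ineg (imul hp0 (isub (imul (imul c6 cl) hq0) (imul (imul c6 cβ) hr))))
    (imul hp1 (imul (imul c6 cβ) hr))) (imul cγ hΦ)
  have hA₁ := isub (iadd (ineg (imul hp0 (imul (imul c6 cβ) hr))) (imul hp1 (imul (imul c6 cβ) hr)))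
    (imul cγ (iadd (ilift c1 2) (imul (imul c3 cβ) (ipow hr 2))))
  -- `|∂_{p₀}G₂| ≤ (ω₂ + 3 lam + 1 + 3β + γ²) K²`, `|∂_{p₁}G₂| ≤ (1 + 3β) K²`
  have hB₀ := iadd (ineg hΦ) (ilift (ipow cγ 2) 2)
  have hB₁ := iadd (ilift c1 2) (imul (imul c3 cβ) (ipow hr 2))
  -- the bond forces `|V'(q₁ - q₀)|, |V'(q₂ - q₁)| ≤ (1 + β) K³`
  have hF₀ := iadd (ilift hr 2) (imul cβ (ipow hr 3))
  have hF₁ := iadd (ilift hs 2) (imul cβ (ipow hs 3))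
  -- `|∂_{q₀}H| ≤ (ω₂ + lam + 1 + β) K³`, `|∂_{q₁}H| ≤ (ω₂ + lam + 2 + 2β) K³`
  have hD₀ := isub (iadd (ilift (imul cω hq0) 2) (imul cl (ipow hq0 3))) hF₀
  have hD₁ := isub (iadd (ilift (imul cω hq1) 2) (imul cl (ipow hq1 3))) (isub hF₁ hF₀)
  -- `|G₃| = |p₀ ∂_{q₀}G₂ + p₁ ∂_{q₁}G₂ - ∂_{q₀}H ∂_{p₀}G₂ - ∂_{q₁}H ∂_{p₁}G₂ - γ p₀ ∂_{p₀}G₂| ≤ C K⁵`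
  have hM := isub (isub (isub (ilift (iadd (imul hp0 hA₀) (imul hp1 hA₁)) 2) (imul hD₀ hB₀)) (imul hD₁ hB₁))
    (ilift (imul cγ (imul hp0 hB₀)) 2)
  calc _ ≤ _ := hM
    _ = C * K ^ 5 := by rw [hC]; ring
    _ ≤ C * (7776 * (1 + (q₀ ^ 6 + p₀ ^ 6) + (q₁ ^ 6 + p₁ ^ 6) + q₂ ^ 6)) :=
        mul_le_mul_of_nonneg_left ((pow_le_pow_right₀ hK1 (by norm_num)).trans hK6) hC0
    _ = _ := by ring

end Summit.AtomisticToContinuum.FouriersLaw.Theorems.CoherentDephasing.StrictAbsorption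

end
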